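import Summits.BirchSwinnertonDyer.BirchSwinnertonDyer.Theorems.DefiniteThetaDerivedHeightCapTowerSqrtAnyPrimeKernels
import Summits.BirchSwinnertonDyer.BirchSwinnertonDyer.Theorems.DefiniteThetaDerivedHeightCapTowerSqrtTowerKernels
import HarnessLib

/-!
# Cyclic multi-step kernels, `Δ` of bounded exponent and maximality of `Δ` — for EVERY prime `p` under `p ≠ 2 ∨ 1 ≤ k`

Route-independent `Theorems` file (cell `b2b-bsdres`, seat `b2b-bsdres-x10b`, gen 45), part 12 of the series «tower square root»
serving crux `DerivedHeightCap` (stmt-BirchSwinnertonDyer-18438, route DefiniteTheta), registered stub `stub_towerSqrt`.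
HONEST FRAMING: no curve asserted, no class closed, BSD not proved by any of this.

`K` imaginary quadratic, `p` ANY prime, `G̃_m = Pic(𝒪_{p^m})`, `Δ_m = torsionImage K p m`, `N_{M,B} = ker(G̃_M → G̃_B)`; the base level is
`k + 1` with the uniform hypothesis `p ≠ 2 ∨ 1 ≤ k` of part 11 (at `p = 2` the base level is `≥ 2`). This is part 5 (§1–§3) verbatim
in that generality:

* §1 `ker_le_zpowers_of_ne_two_or`: `N_{M,k+1} ⊆ ⟨h⟩` for any `h ∈ N_{M,k+1}` not dying in `G̃_{k+2}` — the multi-step kernels are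
  CYCLIC; `zpow_prime_pow_eq_one_iff_dvd_of_ne_two_or`: `h^a` is a `p`-th power in `⟨h⟩` iff `p ∣ a`.
* §2 `eq_one_of_mem_torsionImage_of_picRes_eq_one_tower_of_ne_two_or` (`Δ_M ∩ N_{M,k+1} = 1`),
  `pow_natCard_torsionImage_eq_one_of_ne_two_or` (elements of `Δ_M` are killed by `#Δ_{k+1}`).
* §3 `mem_torsionImage_of_forall_lift_of_ne_two_or` (MAXIMALITY of `Δ`): lifts with `p`-th power in `Δ` at all levels force
  membership in `Δ_{k+1}`.

## References
* [BertoliniDarmon2005] §1.2 (18)–(21); [DarmonIovita2008] §2.2; [Cox2013] §7.D Thm. 7.24.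
-/

noncomputable section

open scoped BigOperators

-- D-0017: single-problem summit, the namespace repeats the problem name by design.
set_option linter.dupNamespace false

namespace Summit.BirchSwinnertonDyer.BirchSwinnertonDyer.Theorems.TowerSqrt

open Literature.NumberTheory.EllipticCurves Literature.NumberTheory.EllipticCurves.QuadOrderTower NumberField
open Summit.BirchSwinnertonDyer.BirchSwinnertonDyer.Theorems.DefmuSupersingularTheta
  (natCard_ker_picRes picRes_mem_torsionImage pow_pow_eq_one_of_picRes_eq_one_tower)

universe u

variable {K : Type u} [Field K] [NumberField K] (p : ℕ) [hp : Fact p.Prime]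

/-! ### §1 The multi-step kernels above the base level are cyclic -/

/-- **`N_{M,k+1} ⊆ ⟨h⟩`** for `M = k+2+j` and any `h ∈ N_{M,k+1}` with `res_{M → k+2} h ≠ 1` (every prime `p`, `p ≠ 2 ∨ 1 ≤ k`): the
kernel of `Pic(𝒪_{p^{k+2+j}}) → Pic(𝒪_{p^{k+1}})` is cyclic, generated by any of its elements not dying in `Pic(𝒪_{p^{k+2}})`.
[cite: BertoliniDarmon2005, §1.2 (18)–(21)] [cite: Cox2013, §7.D Thm. 7.24] -/
theorem ker_le_zpowers_of_ne_two_or (hK : IsImaginaryQuadratic K) (k j : ℕ) (hpk : p ≠ 2 ∨ 1 ≤ k) :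
    ∀ (M : ℕ) (hM : M = k + 2 + j) (h : ClassGroup (quadOrder K (p ^ M))),
      picRes K (pow_dvd_pow p (by omega : k + 1 ≤ M)) h = 1 →
      picRes K (pow_dvd_pow p (by omega : k + 2 ≤ M)) h ≠ 1 →
      ∀ n : ClassGroup (quadOrder K (p ^ M)), picRes K (pow_dvd_pow p (by omega : k + 1 ≤ M)) n = 1 →
        n ∈ Subgroup.zpowers h := by
  induction j with
  | zero =>
    intro M hM h h1 h2 n hn
    subst hM
    have h2' : h ≠ 1 := fun he => h2 (by rw [he, map_one])
    have hcard : Nat.card (picRes K (pow_dvd_pow p (k + 1).le_succ)).ker = p := natCard_ker_picRes p hK k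
    have hmem : (⟨n, hn⟩ : (picRes K (pow_dvd_pow p (k + 1).le_succ)).ker) ∈
        Subgroup.zpowers (⟨h, h1⟩ : (picRes K (pow_dvd_pow p (k + 1).le_succ)).ker) :=
      mem_zpowers_of_prime_card hcard (fun heq => h2' (congrArg Subtype.val heq))
    obtain ⟨z, hz⟩ := Subgroup.mem_zpowers_iff.mp hmem
    have hz' : h ^ z = n := by
      have := congrArg Subtype.val hz
      simpa using this
    rw [← hz']
    exact Subgroup.zpow_mem _ (Subgroup.mem_zpowers h) _
  | succ j ih =>
    intro M hM h h1 h2 n hn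
    have hM' : M = (k + j + 1) + 2 := by omega
    subst hM'
    -- one level down
    set h' := picRes K (pow_dvd_pow p (k + j + 1 + 1).le_succ) h with hh'
    set n' := picRes K (pow_dvd_pow p (k + j + 1 + 1).le_succ) n with hn'
    have h1' : picRes K (pow_dvd_pow p (by omega : k + 1 ≤ k + j + 1 + 1)) h' = 1 := by
      rw [hh', picRes_picRes]; exact h1
    have h2' : picRes K (pow_dvd_pow p (by omega : k + 2 ≤ k + j + 1 + 1)) h' ≠ 1 := by
      rw [hh', picRes_picRes]; exact h2
    have hn1 : picRes K (pow_dvd_pow p (by omega : k + 1 ≤ k + j + 1 + 1)) n' = 1 := by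
      rw [hn', picRes_picRes]; exact hn
    obtain ⟨a, ha⟩ := Subgroup.mem_zpowers_iff.mp (ih (k + j + 1 + 1) (by omega) h' h1' h2' n' hn1)
    -- n * h^{-a} lies in the one-step kernel, which has order p and contains h^{p^{j+1}} ≠ 1
    have hker : picRes K (pow_dvd_pow p (k + j + 1 + 1).le_succ) (n * (h ^ a)⁻¹) = 1 := by
      rw [map_mul, map_inv, map_zpow, ← hh', ha, ← hn', mul_inv_cancel]
    have hu1 : picRes K (pow_dvd_pow p (k + j + 1 + 1).le_succ) (h ^ p ^ (j + 1)) = 1 := by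
      rw [map_pow, ← hh']
      exact pow_pow_eq_one_of_picRes_eq_one_tower p hK (j + 1) k (k + j + 1 + 1) (by omega) h' h1'
    have hu2 : h ^ p ^ (j + 1) ≠ 1 :=
      pow_pow_ne_one_of_picRes_of_ne_two_or p hK (j + 1) k hpk (k + j + 1 + 2) (by omega) h h1 h2
    have hcard : Nat.card (picRes K (pow_dvd_pow p (k + j + 1 + 1).le_succ)).ker = p :=
      natCard_ker_picRes p hK (k + j + 1)
    -- inside the kernel (a group of prime order) every element is a power of h^{p^{j+1}}
    have hmem : (⟨n * (h ^ a)⁻¹, hker⟩ : (picRes K (pow_dvd_pow p (k + j + 1 + 1).le_succ)).ker) ∈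
        Subgroup.zpowers (⟨h ^ p ^ (j + 1), hu1⟩ : (picRes K (pow_dvd_pow p (k + j + 1 + 1).le_succ)).ker) :=
      mem_zpowers_of_prime_card hcard (fun heq => hu2 (congrArg Subtype.val heq))
    obtain ⟨z, hz⟩ := Subgroup.mem_zpowers_iff.mp hmem
    have hz' : (h ^ p ^ (j + 1)) ^ z = n * (h ^ a)⁻¹ := by
      have := congrArg Subtype.val hz
      simpa using this
    have hn_eq : n = h ^ (a + (p ^ (j + 1) : ℕ) * z) := by
      rw [zpow_add, zpow_mul, zpow_natCast, hz', mul_comm, inv_mul_cancel_right]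
    rw [hn_eq]
    exact Subgroup.zpow_mem _ (Subgroup.mem_zpowers h) _

/-- `h^a` is a `p`-th power inside `⟨h⟩` iff `p ∣ a`, for a kernel generator `h ∈ N_{k+2+j', k+1}` with `res_{→k+2} h ≠ 1` (order
`p^{j'+1}`; every prime `p`, `p ≠ 2 ∨ 1 ≤ k`). [cite: Cox2013, §7.D Thm. 7.24] -/
theorem zpow_prime_pow_eq_one_iff_dvd_of_ne_two_or (hK : IsImaginaryQuadratic K) (k j' : ℕ) (hpk : p ≠ 2 ∨ 1 ≤ k) (M : ℕ)
    (hM : M = k + 2 + j') (h : ClassGroup (quadOrder K (p ^ M))) (h1 : picRes K (pow_dvd_pow p (by omega : k + 1 ≤ M)) h = 1)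
    (h2 : picRes K (pow_dvd_pow p (by omega : k + 2 ≤ M)) h ≠ 1) (a : ℤ) :
    (∃ ν : ClassGroup (quadOrder K (p ^ M)), ν ∈ Subgroup.zpowers h ∧ ν ^ p = h ^ a) ↔ (p : ℤ) ∣ a := by
  have hord1 : h ^ p ^ (j' + 1) = 1 := pow_pow_eq_one_of_picRes_eq_one_tower p hK (j' + 1) k M (by omega) h h1
  have hord2 : h ^ p ^ j' ≠ 1 := pow_pow_ne_one_of_picRes_of_ne_two_or p hK j' k hpk M hM h h1 h2
  have hord : orderOf h = p ^ (j' + 1) := by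
    obtain ⟨i, hi, heq⟩ := (Nat.dvd_prime_pow hp.out).mp (orderOf_dvd_of_pow_eq_one hord1)
    rw [heq]
    rcases Nat.lt_or_ge i (j' + 1) with hlt | hge
    · exfalso
      apply hord2
      have : orderOf h ∣ p ^ j' := heq ▸ pow_dvd_pow p (by omega)
      exact orderOf_dvd_iff_pow_eq_one.mp this
    · have : i = j' + 1 := le_antisymm hi hge
      rw [this]
  constructor
  · rintro ⟨ν, hν, hνp⟩
    obtain ⟨b, rfl⟩ := Subgroup.mem_zpowers_iff.mp hν
    rw [← zpow_natCast, ← zpow_mul] at hνp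
    -- h^{bp} = h^a ⇒ ord h ∣ a - bp
    have hdvd : (orderOf h : ℤ) ∣ a - b * p := (zpow_eq_zpow_iff_modEq.mp hνp).dvd
    rw [hord] at hdvd
    push_cast at hdvd
    have hp1 : (p : ℤ) ∣ (p : ℤ) ^ (j' + 1) := dvd_pow_self _ (by omega)
    have h3 : (p : ℤ) ∣ (a - b * p) + b * p := dvd_add (hp1.trans hdvd) (dvd_mul_left _ _)
    rwa [sub_add_cancel] at h3
  · rintro ⟨c, rfl⟩
    exact ⟨h ^ c, Subgroup.zpow_mem _ (Subgroup.mem_zpowers h) c, by rw [← zpow_natCast, ← zpow_mul, mul_comm]⟩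

/-! ### §2 `Δ` along many steps: injective, of bounded exponent -/

/-- **`Δ_M ∩ N_{M,k+1} = 1`** (`M = k+1+j`; `K` imaginary quadratic, every prime `p`, `p ≠ 2 ∨ 1 ≤ k`): iterate of the one-step
statement of part 11 §4. [cite: DarmonIovita2008, §2.2] [cite: BertoliniDarmon2005, §1.2 (21)] -/
theorem eq_one_of_mem_torsionImage_of_picRes_eq_one_tower_of_ne_two_or (hK : IsImaginaryQuadratic K) (k j : ℕ)
    (hpk : p ≠ 2 ∨ 1 ≤ k) :
    ∀ (M : ℕ) (hM : M = k + 1 + j) {t : ClassGroup (quadOrder K (p ^ M))}, t ∈ torsionImage K p M →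
      picRes K (pow_dvd_pow p (by omega : k + 1 ≤ M)) t = 1 → t = 1 := by
  induction j with
  | zero =>
    intro M hM t _ ht1
    subst hM
    exact (picRes_self _ t).symm.trans ht1
  | succ j ih =>
    intro M hM t ht ht1
    have hM' : M = (k + j) + 2 := by omega
    subst hM'
    have hres : picRes K (pow_dvd_pow p (k + j + 1).le_succ) t = 1 := by
      refine ih (k + j + 1) (by omega) (picRes_mem_torsionImage p (k + j + 1).le_succ ht) ?_
      rw [picRes_picRes]; exact ht1
    exact eq_one_of_mem_torsionImage_of_picRes_eq_one_of_ne_two_or p hK (k + j)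
      (hpk.imp_right fun h => le_trans h (Nat.le_add_right k j)) ht hres

/-- **Elements of `Δ_M` are killed by `#Δ_{k+1}`** (`M = k+1+j`; every prime `p`, `p ≠ 2 ∨ 1 ≤ k`). [cite: BertoliniDarmon2005, §1.2 (21)] -/
theorem pow_natCard_torsionImage_eq_one_of_ne_two_or (hK : IsImaginaryQuadratic K) (k j : ℕ) (hpk : p ≠ 2 ∨ 1 ≤ k) (M : ℕ)
    (hM : M = k + 1 + j) {t : ClassGroup (quadOrder K (p ^ M))} (ht : t ∈ torsionImage K p M) :
    t ^ Nat.card (torsionImage K p (k + 1)) = 1 := by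
  refine eq_one_of_mem_torsionImage_of_picRes_eq_one_tower_of_ne_two_or p hK k j hpk M hM (Subgroup.pow_mem _ ht _) ?_
  rw [map_pow]
  have hmem : picRes K (pow_dvd_pow p (by omega : k + 1 ≤ M)) t ∈ torsionImage K p (k + 1) :=
    picRes_mem_torsionImage p (by omega) ht
  have := pow_card_eq_one' (G := torsionImage K p (k + 1)) (x := ⟨_, hmem⟩)
  exact congrArg Subtype.val this

/-! ### §3 Maximality of `Δ` -/

/-- **Maximality of `Δ` seen from the quotient tower** (every prime `p`, `p ≠ 2 ∨ 1 ≤ k`): if `x ∈ G̃_{k+1}` has, at every level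
`M ≥ k+1`, a lift `y` with `y^p ∈ Δ_M`, then `x ∈ Δ_{k+1}` (the lifts have the uniform exponent `p · #Δ_{k+1}`, §2).
[cite: BertoliniDarmon2005, §1.2 (18)–(21)] -/
theorem mem_torsionImage_of_forall_lift_of_ne_two_or (hK : IsImaginaryQuadratic K) (k : ℕ) (hpk : p ≠ 2 ∨ 1 ≤ k)
    (x : ClassGroup (quadOrder K (p ^ (k + 1))))
    (hx : ∀ (j M : ℕ) (hM : M = k + 1 + j), ∃ y : ClassGroup (quadOrder K (p ^ M)),
      picRes K (pow_dvd_pow p (by omega : k + 1 ≤ M)) y = x ∧ y ^ p ∈ torsionImage K p M) :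
    x ∈ torsionImage K p (k + 1) := by
  haveI : Finite (torsionImage K p (k + 1)) := by
    haveI := finite_classGroup (K := K) (p ^ (k + 1))
    infer_instance
  have hD : 0 < Nat.card (torsionImage K p (k + 1)) := Nat.card_pos
  refine ⟨p * Nat.card (torsionImage K p (k + 1)), Nat.mul_pos hp.out.pos hD, fun M hMle => ?_⟩
  obtain ⟨j, hj⟩ := Nat.exists_eq_add_of_le hMle
  obtain ⟨y, hyx, hyp⟩ := hx j M hj
  refine ⟨y, ?_, hyx⟩
  rw [pow_mul]
  exact pow_natCard_torsionImage_eq_one_of_ne_two_or p hK k j hpk M hj hyp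

end Summit.BirchSwinnertonDyer.BirchSwinnertonDyer.Theorems.TowerSqrt

end
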